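import Summits.Ventures.CertifiedManyBodySolver.Observables.StiffnessApexTransportStemDoped
import Summits.Ventures.CertifiedManyBodySolver.Observables.StiffnessHalfBathtubChord
import HarnessLib

/-!
# Ventures/CertifiedManyBodySolver — Observables/StiffnessApexTransportStemKinematic.lean

HONEST FRAMING: one-sided certified CEILINGS on the uniform flux stiffness (`t–t′` f-sum class) on a `(t′, U)[× n]` BOX, assembled from ONE-BODY
KINEMATICS (half-bathtub corner rows, node-free, content-free by construction) and ONE vertical line of many-body sources (the «stem»); a ceiling
never speaks to the presence of order; not a `T_c` estimate, not a superconductivity verdict; every leaf is CONDITIONAL on the row family and the two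
corner certificates it names. Zero compute, no definition, no claim node, no `sorry`.

Cell `pub/hubbard-downfold` (D-0150 L-DF2 «box ↦ one word»), seat `hubbard-downfold-unc-2` (`prover-hubbard-downfold-unc-2-g17-0`). THE RECIPE this
seat arrived at on the La₂CuO₄ parent box «La214-E» (`Downfold/BoxesLa214V115M2b{KinematicSlab11o40, LeftStem, LeftStemK1}`), stated ONCE for every box
`[p, q] × [U_A, U_max]` (`p ≤ t⋆ < q < 0 < U_A`) at a bar `c`:

  (K) TWO half-bathtub CORNER rows at `t⋆` and `q` (levels `ν⋆, ν_q`, top filling `n₂`) with corner values `c⋆, c_q`, `c_q ≤ c⋆ ≤ c`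
      ⇒ the SLAB `t′ ∈ [t⋆, q]` carries `ObsStiffnessSeqCeilingAt t′ U n c` at EVERY `U`, every `0 ≤ n ≤ n₂` (`ObsStiffnessSeqCeilingAt_subinterval_of_corners_le`);
  (S) ONE own-word (n = 1) / target-slot (any n) orbit-lower family on the STEM `{p} × [U₀, U_L]` with `U₀ ≤ U_A(2 − p/t⋆)`, `U_max ≤ U_L`, priced `≤ c`
      ⇒ the STRIP `t′ ∈ [p, t⋆]` (`ObsStiffnessSeqCeilingAt_on_box_of_leftStem_orbitLower` / `…_targetSlot`);
  ⇒ the whole box. No station bundle, no overhang, no slot read at n = 1, no `K₂` leg, no point tile. The deeper the kinematic slab (`t⋆` closer to `p`),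
  the shorter the foot below the box (`U₀ → U_A` as `t⋆ → p`).

* §1 `ObsStiffnessSeqCeilingAt_halfFilling_on_box_of_kinCorners_and_leftStem` (n = 1);
* §2 `ObsStiffnessSeqCeilingAt_on_box3_of_kinCorners_and_leftStem_targetSlot` (3-D box `× [n₁, n₂]`, target-slot stem);
* §3 the foot arithmetic `leftStem_foot_le_station` (`U_A(2 − p/t⋆) ≤ U_A` iff … — recorded as the identity `U_A(2 − p/t⋆) = U_A − U_A(p − t⋆)/t⋆`).

WORKED INSTANCE (numbers of record elsewhere, [exact]): La214-E `p = −3/10`, `q = −1/5`, `U_A = 29/5`, `U_max = 74/5`, bar `0.4364687`: `t⋆ = −11/40` (M = 256 row,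
corner `0.4361541`), `c_q = 0.4263551` (M = 128), foot `U₀ = 58/11`; the stem `{−3/10} × [58/11, 74/5]` has certified vertices at `29/5, 6, 8` (0.387 / 0.380 / 0.318)
and needs ONE new vertex at the foot — `Downfold/BoxesLa214V115M2bLeftStem*.lean` use the point tiles above `U = 39/5` instead of the stem top `[39/5, 74/5]`.

References: T. Hazra, N. Verma, M. Randeria, PRX 9 (2019) 031049, eqs. (2)–(6) [HazraVermaRanderia2019]; T. Koma, H. Tasaki, J. Stat. Phys. 76 (1994)
745, §1 [KomaTasaki1994]; D. J. Scalapino, S. R. White, S.-C. Zhang, PRB 47 (1993) 7995, §II [ScalapinoWhiteZhang1993].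
-/

noncomputable section

namespace Summit.Ventures.CertifiedManyBodySolver.Observables

open Set Real MeasureTheory
open Literature.MathematicalPhysics.QuantumLattice
open Literature.MathematicalPhysics.QuantumLattice.ThermodynamicLimit
open Literature.MathematicalPhysics.QuantumFieldTheory
open Literature.Probability.LatticeModels
open Matrix Finset Filter Topology HubbardWave0
open scoped Matrix BigOperators ComplexOrder

section Recipe

variable {p q tstar UA Umax U₀ UL ν₁ ν₂ c₁ c₂ n₁ n₂ : ℝ}

/-- **THE n = 1 BOX RECIPE: TWO KINEMATIC CORNERS + ONE STEM.** Box `[p, q] × [U_A, U_max]` with `p ≤ t⋆ < q < 0 < U_A`, bar `c`. (K) half-bathtub corner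
certificates at `(t⋆, ν₁)` and `(q, ν₂)` for the top filling `n₂ = 1` with values `c₁, c₂`, `c₂ ≤ c₁ ≤ c`; (S) an own-word orbit-lower family `valL` on the stem
`{p} × [U₀, U_L]`, `0 ≤ U₀ ≤ U_A(2 − p/t⋆)`, `U_max ≤ U_L`, priced `−valL ≤ c`. Then `ObsStiffnessSeqCeilingAt t′ U 1 c` on the whole box: `t′ ≥ t⋆` by the
kinematic chord (node-free), `t′ ≤ t⋆` by the stem (its foot reaches exactly the strip `[p, t⋆]`).
[cite: HazraVermaRanderia2019, eqs. (2)-(6)] [cite: KomaTasaki1994, §1] -/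
theorem ObsStiffnessSeqCeilingAt_halfFilling_on_box_of_kinCorners_and_leftStem (hpt : p ≤ tstar) (htq : tstar < q) (hq : q < 0)
    (hUA : 0 < UA) (hν₁ : 0 ≤ ν₁) (hν₂ : 0 ≤ ν₂) (c : ℚ) (hc₁₂ : c₂ ≤ c₁) (hc₁ : c₁ ≤ ((c : ℚ) : ℝ))
    (h₁ : ν₁ * 1 / 2 +
      (∫ y in (-π)..π, ∫ x in (-π)..π, max (Real.cos x + Real.cos y + 4 * tstar * (Real.cos x * Real.cos y) - ν₁) 0) /
        (4 * π ^ 2) ≤ c₁)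
    (h₂ : ν₂ * 1 / 2 +
      (∫ y in (-π)..π, ∫ x in (-π)..π, max (Real.cos x + Real.cos y + 4 * q * (Real.cos x * Real.cos y) - ν₂) 0) /
        (4 * π ^ 2) ≤ c₂)
    (hU₀ : 0 ≤ U₀) (hfoot : U₀ ≤ UA * (2 - p / tstar)) (htop : Umax ≤ UL) (valL : ℝ → ℝ)
    (hL : ∀ U' ∈ Set.Icc U₀ UL,
      ∀ (ω : InfVolFermionState 2) (Ls : ℕ → ℕ) (ψ : ∀ L, Fock (Orb (FermionTorus 2 L))),
      Tendsto Ls atTop atTop →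
      (∀ j, IsGroundStateInSector (hubbardTorusTT' (Ls j) 1 p U') (rectN 1 (Ls j)) 0 (ψ (Ls j))) →
      (∀ j, star (ψ (Ls j)) ⬝ᵥ ψ (Ls j) = 1) → ω.IsTorusLimitOf ψ Ls →
      valL U' ≤ ((Finset.univ : Finset (DihedralGroup 4)).card : ℝ)⁻¹ * ∑ g ∈ (Finset.univ : Finset (DihedralGroup 4)),
        (ω.expect (d4ShiftSet g 0 (box 2 7)) (fermionEmbed (PolySite.d4Emb g 0 (box 2 7)) (-oddMomentObsTT p U' 0))).re)
    (hcL : ∀ U' ∈ Set.Icc U₀ UL, -valL U' ≤ ((c : ℚ) : ℝ)) :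
    ∀ tp ∈ Set.Icc p q, ∀ U ∈ Set.Icc UA Umax, ObsStiffnessSeqCeilingAt tp U 1 c := by
  intro tp htp U hU
  rcases le_total tstar tp with hk | hk
  · -- (K) the kinematic slab `[t⋆, q]`: chord of the two corners, non-increasing toward `q`, under `c` at `t⋆`
    exact ObsStiffnessSeqCeilingAt_subinterval_of_corners_le hν₁ hν₂ htq (by norm_num) hc₁₂ h₁ h₂ (s := tstar) le_rfl c
      (by
        have hd : 0 < q - tstar := sub_pos.2 htq
        rw [show (q - tstar) / (q - tstar) = 1 from div_self hd.ne', sub_self, zero_div, zero_mul, add_zero, one_mul]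
        exact hc₁)
      ⟨hk, htp.2⟩ zero_le_one le_rfl
  · -- (S) the strip `[p, t⋆]`: the stem
    have ht0 : tstar < 0 := htq.trans hq
    exact ObsStiffnessSeqCeilingAt_halfFilling_on_box_of_leftStem_orbitLower (q := tstar) (Umax := Umax) hpt ht0 hUA hU₀ hfoot htop
      valL c hL hcL tp ⟨htp.1, hk⟩ U hU

/-- **THE 3-D BOX RECIPE (any density interval `[n₁, n₂] ⊆ [0, 2)`): TWO KINEMATIC CORNERS + ONE TARGET-SLOT STEM.** Box `[p, q] × [U_A, U_max] × [n₁, n₂]`,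
`p ≤ t⋆ < q < 0 < U_A`, bar `c`. (K) corner certificates at `(t⋆, ν₁)`, `(q, ν₂)` for the top filling `n₂` with `c₂ ≤ c₁ ≤ c` ⇒ the slab `[t⋆, q]` at every
`n ≤ n₂`; (S) a density-indexed target-slot family `valL x σ U′` on slots `σ ∈ [p, t⋆]`, stem `U′ ∈ [U₀, U_L]` (`0 ≤ U₀ ≤ U_A(2 − p/t⋆)`, `U_max ≤ U_L`), priced
`≤ c` ⇒ the strip. [cite: HazraVermaRanderia2019, eqs. (2)-(6)] [cite: KomaTasaki1994, §1] -/
theorem ObsStiffnessSeqCeilingAt_on_box3_of_kinCorners_and_leftStem_targetSlot (hpt : p ≤ tstar) (htq : tstar < q) (hq : q < 0)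
    (hUA : 0 < UA) (hn₁ : 0 ≤ n₁) (hn₂ : n₂ < 2) (hν₁ : 0 ≤ ν₁) (hν₂ : 0 ≤ ν₂) (c : ℚ) (hc₁₂ : c₂ ≤ c₁) (hc₁ : c₁ ≤ ((c : ℚ) : ℝ))
    (h₁ : ν₁ * n₂ / 2 +
      (∫ y in (-π)..π, ∫ x in (-π)..π, max (Real.cos x + Real.cos y + 4 * tstar * (Real.cos x * Real.cos y) - ν₁) 0) /
        (4 * π ^ 2) ≤ c₁)
    (h₂ : ν₂ * n₂ / 2 +
      (∫ y in (-π)..π, ∫ x in (-π)..π, max (Real.cos x + Real.cos y + 4 * q * (Real.cos x * Real.cos y) - ν₂) 0) /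
        (4 * π ^ 2) ≤ c₂)
    (hU₀ : 0 ≤ U₀) (hfoot : U₀ ≤ UA * (2 - p / tstar)) (htop : Umax ≤ UL) (valL : ℝ → ℝ → ℝ → ℝ)
    (hL : ∀ x ∈ Set.Icc n₁ n₂, ∀ σ ∈ Set.Icc p tstar, ∀ U' ∈ Set.Icc U₀ UL,
      ∀ (ω : InfVolFermionState 2) (Ls : ℕ → ℕ) (ψ : ∀ L, Fock (Orb (FermionTorus 2 L))),
      Tendsto Ls atTop atTop →
      (∀ j, IsGroundStateInSector (hubbardTorusTT' (Ls j) 1 p U') (rectN x (Ls j)) 0 (ψ (Ls j))) →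
      (∀ j, star (ψ (Ls j)) ⬝ᵥ ψ (Ls j) = 1) → ω.IsTorusLimitOf ψ Ls →
      valL x σ U' ≤ ((Finset.univ : Finset (DihedralGroup 4)).card : ℝ)⁻¹ * ∑ g ∈ (Finset.univ : Finset (DihedralGroup 4)),
        (ω.expect (d4ShiftSet g 0 (box 2 7)) (fermionEmbed (PolySite.d4Emb g 0 (box 2 7)) (-oddMomentObsTT σ U' 0))).re)
    (hcL : ∀ x ∈ Set.Icc n₁ n₂, ∀ σ ∈ Set.Icc p tstar, ∀ U' ∈ Set.Icc U₀ UL, -valL x σ U' ≤ ((c : ℚ) : ℝ)) :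
    ∀ tp ∈ Set.Icc p q, ∀ U ∈ Set.Icc UA Umax, ∀ x ∈ Set.Icc n₁ n₂, ObsStiffnessSeqCeilingAt tp U x c := by
  intro tp htp U hU x hx
  rcases le_total tstar tp with hk | hk
  · exact ObsStiffnessSeqCeilingAt_subinterval_of_corners_le hν₁ hν₂ htq hn₂.le hc₁₂ h₁ h₂ (s := tstar) le_rfl c
      (by
        have hd : 0 < q - tstar := sub_pos.2 htq
        rw [show (q - tstar) / (q - tstar) = 1 from div_self hd.ne', sub_self, zero_div, zero_mul, add_zero, one_mul]
        exact hc₁)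
      ⟨hk, htp.2⟩ (hn₁.trans hx.1) hx.2
  · have ht0 : tstar < 0 := htq.trans hq
    exact ObsStiffnessSeqCeilingAt_on_box3_of_leftStem_targetSlot (q := tstar) (Umax := Umax) hpt ht0 hUA hU₀ hfoot htop hn₁ hn₂ valL c
      hL hcL tp ⟨htp.1, hk⟩ U hU x hx

/-- **Foot arithmetic.** `U_A(2 − p/t⋆) = U_A − U_A·(p − t⋆)/t⋆`: the foot lies below the box bottom by `U_A(p − t⋆)/t⋆ ≥ 0` (`p ≤ t⋆ < 0`), vanishing as the
kinematic slab reaches the box edge `t⋆ → p`. [folklore] -/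
theorem leftStem_foot_eq (UA p : ℝ) {tstar : ℝ} (ht : tstar ≠ 0) : UA * (2 - p / tstar) = UA - UA * (p - tstar) / tstar := by
  field_simp
  ring

/-- The foot is at or below the box bottom: `U_A(2 − p/t⋆) ≤ U_A` for `p ≤ t⋆ < 0 ≤ U_A`. [folklore] -/
theorem leftStem_foot_le_station {UA p tstar : ℝ} (hUA : 0 ≤ UA) (hpt : p ≤ tstar) (ht : tstar < 0) : UA * (2 - p / tstar) ≤ UA := by
  have h1 : 1 ≤ p / tstar := by rw [le_div_iff_of_neg ht, one_mul]; exact hpt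
  nlinarith

end Recipe

end Summit.Ventures.CertifiedManyBodySolver.Observables

end
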